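import Summits.CriticalPhenomena.Ising3DConformalLimit.Theorems.RotationJoining.Negative.RotationJoiningFalseWithoutGibbs
import Summits.CriticalPhenomena.Ising3DConformalLimit.Theorems.SynchronousCouplingDefs

/-!
# `RotationJoining` (crux stmt-CriticalPhenomena-18763), negative-side support, module 7:
# the findings in the picked line's vocabulary; the QUALITATIVE joining is false without Gibbs

The picked line `SketchIdeator2` (`Cruxes.RotationJoining.RateSplitting`, `Theorems/SynchronousCouplingDefs.lean`)
reads the crux through `tiltCell`, `axisCell`, `blockSum`, `normTilt`, `normAxis`. These are the SAME terms as this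
lane's `rotCell`, `axisCell`, `blockSum`, `normaliser μ (rotCell₀ n m)`, `normaliser μ (axisCell₀ n)` (bridges
below, `rfl` up to `rotCell_zero` / `axisCell_zero`), so the line's per-block `L²` defect is `defect μ n m u π`
(`lineDefect_eq`).

Main statement (`qualitativeRotationJoining_false_without_gibbs`): the line's `QualitativeRotationJoining` — the crux
with its power rate `C n^(-θ)` replaced by an arbitrary `ε > 0` beyond a window-uniform scale `N(ε)` — is FALSE once
`μ ∈ 𝒢(β_c)` is weakened to "translation-invariant probability measure": for the layered i.i.d. measure `μL`
(module 4) and EVERY coupling `π` of `μL` with itself, at every scale `n = 3k` one of the two blocks `u = 0`, `u = e₀`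
of window `m = 1` has defect `≥ 1/150` (`defect_pair_lower_bound`), so `ε = 1/151` admits no `N`. Since the rate
version implies the qualitative one measure by measure, this sharpens module 4's `rotationJoining_false_without_gibbs`
(restated in the line's vocabulary as `rotationJoiningLine_false_without_gibbs`): within the line, the Gibbs /
cubic-symmetry input is load-bearing already for `Sig.stub_qualitativeRotationJoining`, not only for the rate.
Refuter cdisprove seat (cycle 1); refutes nothing (the crux keeps its Gibbs hypothesis).
-/

namespace Summit.CriticalPhenomena.Ising3DConformalLimit.Theorems.RotationJoining.Negative

open MeasureTheory Filter Finset
open Literature.Probability.LatticeModels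
open Summit.CriticalPhenomena.Ising3DConformalLimit.Cruxes.RotationJoining

noncomputable section

/-! ### Vocabulary bridges (`RateSplitting` ↔ this lane) -/

/-- The line's tilted cell is this lane's rotated cell (same term). -/
theorem tiltCell_eq_rotCell (n m : ℕ) (u : Fin 3 → ℤ) : RateSplitting.tiltCell n m u = rotCell n m u := rfl

/-- The line's axis cell is this lane's axis cell (same term). -/
theorem lineAxisCell_eq (n : ℕ) (u : Fin 3 → ℤ) : RateSplitting.axisCell n u = axisCell n u := rfl

/-- The line's block sum is this lane's block sum (same term). -/
theorem lineBlockSum_eq (S : Finset (Site 3)) (σ : SpinConfig (Site 3)) :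
    RateSplitting.blockSum S σ = blockSum S σ := rfl

/-- The line's tilted normaliser is `normaliser μ (rotCell₀ n m)`. -/
theorem normTilt_eq (μ : Measure (SpinConfig (Site 3))) (n m : ℕ) :
    RateSplitting.normTilt μ n m = normaliser μ (rotCell₀ n m) := by
  rw [← rotCell_zero]; rfl

/-- The line's axis normaliser is `normaliser μ (axisCell₀ n)`. -/
theorem normAxis_eq (μ : Measure (SpinConfig (Site 3))) (n : ℕ) :
    RateSplitting.normAxis μ n = normaliser μ (axisCell₀ n) := by
  rw [← axisCell_zero]; rfl

/-- The line's per-block `L²` defect under a coupling `π` is this lane's `defect μ n m u π`. -/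
theorem lineDefect_eq (μ : Measure (SpinConfig (Site 3))) (n m : ℕ) (u : Fin 3 → ℤ)
    (π : Measure (SpinConfig (Site 3) × SpinConfig (Site 3))) :
    ∫ q, (RateSplitting.normTilt μ n m * RateSplitting.blockSum (RateSplitting.tiltCell n m u) q.1 -
        RateSplitting.normAxis μ n * RateSplitting.blockSum (RateSplitting.axisCell n u) q.2) ^ 2 ∂π =
      defect μ n m u π := by
  simp only [normTilt_eq, normAxis_eq, tiltCell_eq_rotCell, lineAxisCell_eq, lineBlockSum_eq]
  rfl

/-- READ-BACK: the line's `QualitativeRotationJoining` is the `ε`-version of the crux over `defect`. -/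
theorem qualitativeRotationJoining_iff_defect :
    RateSplitting.QualitativeRotationJoining ↔
      ∀ μ ∈ isingGibbsMeasures 3 (criticalBeta 3) 0, IsTranslationInvariantMeasure μ →
        ∀ ε : ℝ, 0 < ε → ∃ N : ℕ, ∀ n m : ℕ, N ≤ n →
          ∃ π : Measure (SpinConfig (Site 3) × SpinConfig (Site 3)), π.fst = μ ∧ π.snd = μ ∧
            ∀ u : Fin 3 → ℤ, (∀ i, |u i| ≤ m) → defect μ n m u π ≤ ε := by
  unfold RateSplitting.QualitativeRotationJoining
  simp only [lineDefect_eq]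

/-! ### The qualitative joining fails without the Gibbs hypothesis -/

/-- **Load-bearing hypothesis, qualitative form.** The line's `QualitativeRotationJoining` with `μ ∈ 𝒢(β_c)`
weakened to `IsProbabilityMeasure μ` is false: witness `μL`, `ε = 1/151`, blocks `u = 0, e₀` of window `1` at the
scales `n = 3k` (`defect_pair_lower_bound`: `max ≥ 1/150` under every coupling). -/
theorem qualitativeRotationJoining_false_without_gibbs :
    ¬ ∀ μ : Measure (SpinConfig (Site 3)), IsProbabilityMeasure μ → IsTranslationInvariantMeasure μ →
        ∀ ε : ℝ, 0 < ε → ∃ N : ℕ, ∀ n m : ℕ, N ≤ n →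
          ∃ π : Measure (SpinConfig (Site 3) × SpinConfig (Site 3)), π.fst = μ ∧ π.snd = μ ∧
            ∀ u : Fin 3 → ℤ, (∀ i, |u i| ≤ m) →
              ∫ q, (RateSplitting.normTilt μ n m * RateSplitting.blockSum (RateSplitting.tiltCell n m u) q.1 -
                  RateSplitting.normAxis μ n * RateSplitting.blockSum (RateSplitting.axisCell n u) q.2) ^ 2 ∂π
                ≤ ε := by
  intro h
  obtain ⟨N, hN⟩ := h μL inferInstance isTranslationInvariant_μL (1 / 151) (by norm_num)
  obtain ⟨π, hfst, hsnd, Hu⟩ := hN (3 * (N + 1)) 1 (by omega)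
  have h0 := Hu 0 (fun i => by simp)
  have h1 := Hu (Pi.single 0 1) abs_single_le
  rw [lineDefect_eq] at h0 h1
  have key := defect_pair_lower_bound (k := N + 1) (by omega) π hfst hsnd h0 h1
  norm_num at key

/-- Hence also without translation invariance as a separate gift: the `ε`-version over ALL probability measures
fails (immediate from the previous theorem). -/
theorem qualitativeRotationJoining_false_forall_prob :
    ¬ ∀ μ : Measure (SpinConfig (Site 3)), IsProbabilityMeasure μ →
        ∀ ε : ℝ, 0 < ε → ∃ N : ℕ, ∀ n m : ℕ, N ≤ n →
          ∃ π : Measure (SpinConfig (Site 3) × SpinConfig (Site 3)), π.fst = μ ∧ π.snd = μ ∧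
            ∀ u : Fin 3 → ℤ, (∀ i, |u i| ≤ m) →
              ∫ q, (RateSplitting.normTilt μ n m * RateSplitting.blockSum (RateSplitting.tiltCell n m u) q.1 -
                  RateSplitting.normAxis μ n * RateSplitting.blockSum (RateSplitting.axisCell n u) q.2) ^ 2 ∂π
                ≤ ε :=
  fun h => qualitativeRotationJoining_false_without_gibbs fun μ hμ _ => h μ hμ

/-- Module 4's `rotationJoining_false_without_gibbs` in the line's vocabulary: the crux body (power rate) over all
translation-invariant probability measures is false. -/
theorem rotationJoiningLine_false_without_gibbs :
    ¬ ∀ μ : Measure (SpinConfig (Site 3)), IsProbabilityMeasure μ → IsTranslationInvariantMeasure μ →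
        ∃ C θ : ℝ, 0 < θ ∧ ∀ n m : ℕ, 1 ≤ n →
          ∃ π : Measure (SpinConfig (Site 3) × SpinConfig (Site 3)), π.fst = μ ∧ π.snd = μ ∧
            ∀ u : Fin 3 → ℤ, (∀ i, |u i| ≤ m) →
              ∫ q, (RateSplitting.normTilt μ n m * RateSplitting.blockSum (RateSplitting.tiltCell n m u) q.1 -
                  RateSplitting.normAxis μ n * RateSplitting.blockSum (RateSplitting.axisCell n u) q.2) ^ 2 ∂π
                ≤ C * (n : ℝ) ^ (-θ) := by
  simp only [lineDefect_eq]
  exact rotationJoining_false_without_gibbs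

end

end Summit.CriticalPhenomena.Ising3DConformalLimit.Theorems.RotationJoining.Negative
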